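import Literature.MathematicalPhysics.QuantumFieldTheory.Balaban1983to89.T4FiniteEpsInhabited
import Literature.MathematicalPhysics.QuantumFieldTheory.Balaban1983to89.T4SummableDefect

/-!
# `T4Continuum.CovariantMeanFlatDatum` (cell-tree module `Summits/QuantumFields/BalabanUV/T4Continuum/Support/CovariantMeanFlatDatum.lean`)
# — the FLAT DATUM: an honestly realised `FiniteEpsData` whose `g₀ = 0` (Wilson `β = 0`) run has the constant density `1` at
# every level, with the axial block averaging and `R := id` (road P4 of the spine estimate NE1′; the carrier of the non-vacuity
# witness `Support/CovariantMeanWitness`)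
# (cell `pub-balaban`, scoping sub-cell `t4`, ROUND-2 prover seat #4 of BINDER-OWNERS row NE1′, unit `b2b-balaban-t4-ne1p-p4`,
# generation 1; ADDITIVE — a new leaf importing `T4FiniteEpsInhabited` (row T4-D.G) and `T4SummableDefect` (the telescoping
# lane's cone, for the shared vocabulary) only; nothing modified)

HONEST FRAMING.  Finite four-torus, rung (B)+1 only.  NOT infinite volume, NOT a mass gap, NOT the Clay problem, NOT summit
progress.  HONEST DEPENDENCY: continuum YM on T⁴ ⇐ BetaPertH ∧ nine spine estimates (0/9 proved); BetaPertH ⇐ (D1) ∧ (D4) ∧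
CAP+tail; G-an2-4 gates asym, D1 and NE2/3/4.  WHAT THIS IS: a second inhabitant of the carrier `T4Continuum.FiniteEpsData F G`,
built exactly like `T4FiniteEpsInhabited.stubData` (placeholder small-field part: constant flow, zero β-functions, empty domains,
`False` representation flags; honest `Realisation` with `cfg = id`, `ρ₀` = the Boltzmann weight, `R := id`) except that the
densities are `flatRho`: at `g₀ = 0` the CONSTANT `1` at every level (which IS the Boltzmann weight at `β = g₀⁻² = 0`, Lean's
`0⁻¹ = 0`, and IS its own renormalisation transform along the Haar-compatible axial averaging — `isRT_one_one`, from
`AveragingRT.map_axialAvg`), at `g₀ ≠ 0` the Radon–Nikodym iterates `rtIterate` of `T4FiniteEpsInhabited`.  WHAT IT IS NOT: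
anything about Bałaban's densities or (B) — `B16.Thm1Printed` FAILS for the flat construction (`not_thm1Printed_flat`), so every
T⁴ target holds vacuously at `flatData`; the value is a datum on which explicit POINTWISE computations are possible at `g₀ = 0`
(all densities `≡ 1`), which the Radon–Nikodym inhabitant does not offer.

CITATION HEADER (lean-in-tree rule).  No page of T. Bałaban's series or of any other source was newly read for this module and
nothing printed is asserted.  Objects re-used BY NAME: `T4FiniteEpsInhabited.rtIterate` / `rtIterate_succ` / `zeroHBeta` /
`isRT_rnTransport_of_ac` / `haarAC_of_map_eq` / `integrable_rtIterate`, `AveragingRT.axial` / `axialAvg` / `map_axialAvg` /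
`measurable_axialAvg`, `Missing.boltzmann`, `T4Spectator.rho`, `B16.Construction` / `Thm1Printed` / `EndStatementBPrinted`,
`DagBinding.CurriesHBeta` / `ForwardGenerated`, `T4Continuum.Realisation` / `FiniteEpsData`.  Every declaration is [folklore]
and sorry-free.  ABSOLUTE RULE honoured.
-/

noncomputable section

open MeasureTheory Filter Topology Metric Set
open scoped BigOperators

namespace Summit.QuantumFields.BalabanUV.T4Continuum.CovariantMeanContraction

open Literature.MathematicalPhysics.QuantumFieldTheory.Balaban1983to89
open T4Continuum T4ExteriorCovariance T4SummableDefect T4ObservableTelescopeTwoRun T4UniformDefectWiring T4ObservableTelescope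
  T4Spectator B15.BasicStep Missing T4FiniteEpsInhabited AveragingRT

/-! ## §1 The flat datum -/

section Flat

variable (F : T4Family) (G : Type) [GaugeGroup G] [MeasurableSpace G] [HaarData G]

/-- The axial block averagings at every level of every torus of the family. [folklore] -/
def axialAv : (K j : ℕ) → Averaging (F.P K) j G := fun _ _ => axial

/-- THE FLAT-OR-HONEST DENSITIES: at bare coupling `g₀ = 0` (Wilson `β = g₀⁻² = 0`, Lean's `0⁻¹ = 0`) the constant density
`1` at every level; at `g₀ ≠ 0` the Radon–Nikodym iterates `rtIterate` of the Boltzmann weight along the axial averagings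
(`T4FiniteEpsInhabited`). [folklore] -/
def flatRho (K : ℕ) (g₀ : ℝ) (k : ℕ) : Density (F.P K) k G :=
  if g₀ = 0 then fun _ => 1 else rtIterate F (axialAv F G) K g₀ k

/-- At `g₀ = 0` the density is the constant `1`. [folklore] -/
@[simp] theorem flatRho_zero (K k : ℕ) : flatRho F G K 0 k = fun _ => 1 := by
  unfold flatRho; rw [if_pos rfl]

/-- At `g₀ ≠ 0` the density is the Radon–Nikodym iterate. [folklore] -/
theorem flatRho_of_ne {g₀ : ℝ} (hg : g₀ ≠ 0) (K k : ℕ) : flatRho F G K g₀ k = rtIterate F (axialAv F G) K g₀ k := by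
  unfold flatRho; rw [if_neg hg]

omit [MeasurableSpace G] [HaarData G] in
/-- The Boltzmann weight at `β = 0` is the constant `1`. [folklore] -/
theorem boltzmann_inv_zero (K : ℕ) (U : GaugeField (F.P K) 0 G) : boltzmann (F.P K) ((0 : ℝ)⁻¹ ^ 2) U = 1 := by
  simp [boltzmann]

/-- THE FLAT CONSTRUCTION: `T4FiniteEpsInhabited.stubConstruction`'s placeholder small-field part (constant flow, zero
β-functions, empty domains, `False` representation flags) with the densities `flatRho`. It asserts NONE of Bałaban's
representations. [folklore] -/
def flatConstruction : B16.Construction := fun p =>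
  { flow := ⟨fun _ => p.g0, fun _ _ => 0⟩
    Cfg := fun k => GaugeField (F.P p.K) k G
    dom := fun _ => ∅
    effAction := fun _ _ => 0
    wilsonBG := fun _ _ => 0
    Ek := fun _ _ => 0
    numSites := fun _ => 0
    Repr := fun _ => False
    IndAss := fun _ => False
    ρ := fun k => flatRho F G p.K p.g0 k
    χ := fun _ _ => 0
    Sect2Form := fun _ => False }

/-- The flat construction's one-variable β-functions are the zero family curried. [folklore] -/
theorem curriesHBeta_flat : DagBinding.CurriesHBeta (flatConstruction F G).toB12 zeroHBeta :=
  fun _ _ _ _ => rfl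

/-- The constant flow is generated forward from the bare coupling by the zero β-functions. [folklore] -/
theorem forwardGenerated_flat : DagBinding.ForwardGenerated (flatConstruction F G).toB12 zeroHBeta := by
  refine ⟨fun _ => rfl, fun p k _ hpos _ => ?_⟩
  have h0 : 0 < p.g0 := hpos 0 (Nat.zero_le _)
  refine ⟨h0, ?_⟩
  show 1 / p.g0 ^ 2 = 1 / p.g0 ^ 2 - 0
  rw [sub_zero]

/-- HONESTY CERTIFICATE: Theorem 1 of [Balaban1989LargeFieldII] in its typed form FAILS for the flat construction (its
`Sect2Form` is `False`), so every `T4Continuum` target holds vacuously at the flat datum. [folklore] -/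
theorem not_thm1Printed_flat : ¬ B16.Thm1Printed (flatConstruction F G) := by
  rintro ⟨γ, hγ, h⟩
  have hint : ((flatConstruction F G) ⟨0, F.m, γ⟩).flow.InInterval γ 0 := fun k _ => ⟨hγ, le_rfl⟩
  exact h ⟨0, F.m, γ⟩ hint 0 le_rfl

variable [RegularGaugeGroup G]

omit [HaarData G] in
/-- The axial averagings are measurable. [folklore] -/
theorem measurable_axialAv (K j : ℕ) : Measurable (axialAv F G K j).avg := measurable_axialAvg

/-- The axial averagings satisfy `HaarAC` in the standing range (they are Haar-compatible, `map_axialAvg`). [folklore] -/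
theorem haarAC_axialAv (K k : ℕ) (hk : k < K) : HaarAC (axialAv F G K k).avg :=
  haarAC_of_map_eq _ (map_axialAvg (by show k + 1 ≤ F.m + K; omega))

/-- The constant density `1` IS the renormalisation transform of the constant density `1` along the axial averaging in the
standing range (push-forward identity from `map_axialAvg`). [folklore] -/
theorem isRT_one_one (K k : ℕ) (hk : k < K) :
    IsRT (axialAv F G K k).avg (fun _ : GaugeField (F.P K) k G => (1 : ℝ)) (fun _ => 1) := by
  intro f hf _
  simp only [one_mul]
  have hmap := map_axialAvg (P := F.P K) (j := k) (G := G) (by show k + 1 ≤ F.m + K; omega)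
  have key := integral_map (μ := fieldMeasure (F.P K) k G) (φ := (axialAv F G K k).avg)
    (measurable_axialAv F G K k).aemeasurable (hf.aestronglyMeasurable (μ := _))
  change ((fieldMeasure (F.P K) k G).map axialAvg) = _ at hmap
  change ∫ y, f y ∂((fieldMeasure (F.P K) k G).map axialAvg) = _ at key
  rw [hmap] at key
  exact key

/-- `flatRho (k+1)` IS the renormalisation transform of `flatRho k` along the axial averaging, `k < K` (both branches).
[folklore] -/
theorem isRT_flatRho (K : ℕ) (g₀ : ℝ) (k : ℕ) (hk : k < K) :
    IsRT (axialAv F G K k).avg (flatRho F G K g₀ k) (flatRho F G K g₀ (k + 1)) := by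
  by_cases hg : g₀ = 0
  · subst hg; rw [flatRho_zero, flatRho_zero]; exact isRT_one_one F G K k hk
  · rw [flatRho_of_ne F G hg, flatRho_of_ne F G hg, rtIterate_succ]
    exact isRT_rnTransport_of_ac _ (measurable_axialAv F G K k) (haarAC_axialAv F G K k hk) _
      (integrable_rtIterate F (axialAv F G) (measurable_axialAv F G) (haarAC_axialAv F G) K g₀ k hk.le)

/-- THE FLAT REALISATION: `cfg` = identity, `ρ₀` = the Boltzmann weight (`c = 1`; at `g₀ = 0` it IS the constant `1`),
`Tρ_k = ρ_{k+1} = flatRho (k+1)` (honest transforms, `isRT_flatRho`), `R := id`. [folklore] -/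
def flatRealisation : T4Continuum.Realisation F G (flatConstruction F G) (axialAv F G) where
  cfg := fun _ _ _ => Equiv.refl _
  rho_zero := fun K g₀ => ⟨1, one_pos, fun U => by
    show flatRho F G K g₀ 0 U = 1 * boltzmann (F.P K) (g₀⁻¹ ^ 2) U
    rw [one_mul]
    by_cases hg : g₀ = 0
    · subst hg; rw [flatRho_zero, boltzmann_inv_zero]
    · rw [flatRho_of_ne F G hg]; rfl⟩
  Trho := fun K g₀ k => flatRho F G K g₀ (k + 1)
  isRT_Trho := fun K g₀ k hk => isRT_flatRho F G K g₀ k hk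
  R := fun _ _ _ => id
  preservesIntegral_R := fun _ _ _ _ _ => rfl
  rho_succ_eq := fun _ _ _ _ => rfl

/-- THE FLAT DATUM. [folklore] -/
def flatData : T4Continuum.FiniteEpsData F G where
  C := flatConstruction F G
  βfun := zeroHBeta
  curries := curriesHBeta_flat F G
  fwd := forwardGenerated_flat F G
  av := axialAv F G
  real := flatRealisation F G

/-- Its `g₀ = 0` transforms are the constant `1`. [folklore] -/
@[simp] theorem flatData_Trho_zero (K k : ℕ) : (flatData F G).real.Trho K 0 k = fun _ => 1 := flatRho_zero F G K (k + 1)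

/-- Its large-field operation is the identity. [folklore] -/
@[simp] theorem flatData_R (K : ℕ) (g₀ : ℝ) (k : ℕ) : (flatData F G).real.R K g₀ k = id := rfl

/-- Its `g₀ = 0` densities are the constant `1`. [folklore] -/
@[simp] theorem rho_flatData_zero (K k : ℕ) : rho (flatData F G) K 0 k = fun _ => 1 := by
  funext U
  show flatRho F G K 0 k ((Equiv.refl _).symm U) = 1
  rw [flatRho_zero]

/-- (B) in its pinned printed form FAILS for the flat datum (honesty: the witness says nothing about the targets). [folklore] -/
theorem not_endStatementBPrinted_flatData : ¬ B16.EndStatementBPrinted (flatData F G).C :=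
  fun h => not_thm1Printed_flat F G h.1

end Flat


end Summit.QuantumFields.BalabanUV.T4Continuum.CovariantMeanContraction
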